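import Literature.Analysis.Complex.SymmetryPrincipleBanach
import Mathlib.Analysis.Normed.Lp.lpSpace
import Mathlib.Topology.ContinuousMap.Bounded.Star
import Mathlib.LinearAlgebra.Complex.Module
import HarnessLib

/-!
# The symmetry (reflection) principle, VECTOR-VALUED, and through Mathlib's `star` conjugations

Analysis∕Complex (theorems only; no definitions, no named facts).  Sibling of
`Literature.Analysis.Complex.SymmetryPrincipleBanach` (the SCALAR-valued case `Φ : E → ℂ` through an abstract conjugation
`σ : E →L[ℝ] E`).  AHLFORS, *Complex Analysis*, Ch. 4 §6.5 «The Symmetry Principle» [cite: AhlforsCA1979, Ch. 4 §6.5 p. 172]: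
*«if f(z) is an analytic function, then \overline{f(z̄)} is also analytic … The proofs of these statements consist in trivial
verifications»*, and, for a symmetric region and f real on the real axis, *«f(z) = \overline{f(z̄)}»*.

THIS FILE performs the same trivial verification for maps `Φ : E → F` BETWEEN two complex normed spaces, each carrying a
conjugation — first abstractly (`σE : E →L[ℝ] E`, `σF : F →L[ℝ] F`, ℝ-linear, continuous, conjugate-linear over `ℂ`), then
for Mathlib's `star` on spaces with `[StarAddMonoid ·] [NormedStarGroup ·] [StarModule ℂ ·]` (e.g. `ℂ`, `ι → ℂ`,
`lp (fun _ : ι => ℂ) ∞`, bounded functions into such spaces):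
* §1 `exists_hasFDerivAt_sandwich` ∕ `differentiableAt_sandwich` ∕ `differentiableOn_sandwich`: `Φ` ℂ-differentiable at `σE z`
  ⇒ `Q ↦ σF (Φ (σE Q))` ℂ-differentiable at `z` with derivative `v ↦ σF (DΦ(σE z)(σE v))` — ℂ-LINEAR, two antilinear maps
  around one linear map (ℝ-chain rule, then `hasFDerivAt_of_restrictScalars`);
* §2 the SYMMETRISED map `Q ↦ 2⁻¹ • (Φ Q + σF (Φ (σE Q)))`: holomorphic on σE-invariant open sets; the SAME bound on balls when
  both σ's are isometric; at a σE-fixed point equal to `2⁻¹ • (Φ Q + σF (Φ Q))` — a σF-FIXED («real») vector —; non-expansive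
  on differences of σE-fixed points; and EQUIVARIANT for involutions, `Φ^sym (σE Q) = σF (Φ^sym Q)` (Ahlfors'
  `f(z) = \overline{f(z̄)}`); bundled `symmetriseV_ball`;
* §3 the `star` FORM: the same statements with `σE := star`, `σF := star` and NO ℝ-linear structure in any statement (the
  ℝ-linear continuous conjugation is built INSIDE the proofs against `NormedSpace.complexToReal`, §3.0, so a space carrying
  its own ℝ-module instance meets no instance mismatch) — `differentiableOn_star_comp_star` (∕ `_ball`), `symmetrise_star_ball`
  (six clauses; fixed points = `IsSelfAdjoint`), `symmetrise_star_eq_realPart` (the value at a self-adjoint point is Mathlib's `ℜ`);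
* §4 the sequence spaces `lp (fun _ : ι => ℂ) ∞` (any index types): the instances §3 needs are Mathlib's (also for bounded
  functions into them); `symmetrise_star_apply_of_isSelfAdjoint` (an `lp`-valued `Φ^sym` at a self-adjoint argument is the
  COORDINATEWISE real part of `Φ`); `symmetrise_star_lp_ball` (tables AND values sequence spaces, bundled, with clause (o): the
  self-adjoint tables are exactly the tables with real coordinates — private helpers `lp_star_apply`, `isSelfAdjoint_lp_iff`,
  `lp_symmetrise_apply`);
* §T sanity: non-vacuity on `lp (fun _ : ι => ℂ) ∞` and the scalar recovery (`F := ℂ`, `star = conj`, value `((Φ Q).re : ℂ)` as in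
  the sibling file's `symmetrise_ball` (iii)).

Mathlib has the one-variable statement `DifferentiableAt.conj_conj` (`f : ℂ → ℂ`); the Banach-valued form through abstract or
`star` conjugations is not in Mathlib (searched `conj_conj`, `star_comp`, `realPart` + `DifferentiableOn`).
Use (cell `pub-balaban`, spine node NE9, route «fading by Earle–Hamilton»): a REAL-PART-valued slice map into a complex
sequence space is complexified by its symmetrised holomorphic extension, so that the real orbit of a recursion is the orbit
of a holomorphic self-map; nothing of that application is in this file.

## References
* L. V. Ahlfors, *Complex Analysis*, 3rd ed., McGraw-Hill 1979, Ch. 4 §6.5 (The Symmetry Principle), p. 172. [AhlforsCA1979]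
-/

noncomputable section

namespace Literature.Analysis.Complex.SymmetryPrincipleBanachStar

open ComplexConjugate ComplexStarModule Metric Set
open scoped ENNReal

section Abstract

variable {E F : Type*} [NormedAddCommGroup E] [NormedSpace ℂ E] [NormedAddCommGroup F] [NormedSpace ℂ F]

/-! ## §1 `Q ↦ σF (Φ (σE Q))` is holomorphic where `Φ` is (vector-valued reflection) -/

/-- **THE SYMMETRY PRINCIPLE, VECTOR-VALUED, pointwise with the derivative.**  `σE`, `σF` ℝ-linear continuous and
conjugate-linear over `ℂ`, `Φ : E → F` ℂ-differentiable at `σE z` ⇒ `Q ↦ σF (Φ (σE Q))` is ℂ-differentiable at `z` and its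
derivative is the ℂ-LINEAR map `v ↦ σF (DΦ(σE z)(σE v))` («\overline{f(z̄)} is also analytic … trivial verifications»: the
ℝ-chain rule for `σF ∘ Φ ∘ σE`, then `hasFDerivAt_of_restrictScalars`). [cite: AhlforsCA1979, Ch. 4 §6.5 p. 172] -/
theorem exists_hasFDerivAt_sandwich (σE : E →L[ℝ] E) (hσE : ∀ (c : ℂ) (x : E), σE (c • x) = conj c • σE x)
    (σF : F →L[ℝ] F) (hσF : ∀ (c : ℂ) (y : F), σF (c • y) = conj c • σF y)
    {Φ : E → F} {z : E} (hΦ : DifferentiableAt ℂ Φ (σE z)) :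
    ∃ L : E →L[ℂ] F, (∀ v, L v = σF (fderiv ℂ Φ (σE z) (σE v))) ∧ HasFDerivAt (fun Q => σF (Φ (σE Q))) L z := by
  -- the candidate derivative IS ℂ-linear: two conjugate-linear maps around one linear map
  let L : E →L[ℂ] F :=
    { toFun := fun v => σF (fderiv ℂ Φ (σE z) (σE v))
      map_add' := fun v w => by simp only [map_add]
      map_smul' := fun c v => by
        rw [hσE c v, map_smul, hσF, Complex.conj_conj, RingHom.id_apply]
      cont := σF.continuous.comp ((fderiv ℂ Φ (σE z)).continuous.comp σE.continuous) }
  refine ⟨L, fun v => rfl, ?_⟩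
  -- over ℝ by the chain rule
  have h1 : HasFDerivAt Φ ((fderiv ℂ Φ (σE z)).restrictScalars ℝ) (σE z) := hΦ.hasFDerivAt.restrictScalars ℝ
  have h2 : HasFDerivAt (fun Q => Φ (σE Q)) (((fderiv ℂ Φ (σE z)).restrictScalars ℝ).comp σE) z :=
    h1.comp z σE.hasFDerivAt
  have h3 : HasFDerivAt (fun Q => σF (Φ (σE Q))) (σF.comp (((fderiv ℂ Φ (σE z)).restrictScalars ℝ).comp σE)) z :=
    σF.hasFDerivAt.comp z h2
  -- and that ℝ-derivative is the restriction of `L`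
  exact hasFDerivAt_of_restrictScalars ℝ h3 (by ext v; rfl)

/-- `DifferentiableAt` form of the vector-valued symmetry principle. [cite: AhlforsCA1979, Ch. 4 §6.5 p. 172] -/
theorem differentiableAt_sandwich (σE : E →L[ℝ] E) (hσE : ∀ (c : ℂ) (x : E), σE (c • x) = conj c • σE x)
    (σF : F →L[ℝ] F) (hσF : ∀ (c : ℂ) (y : F), σF (c • y) = conj c • σF y)
    {Φ : E → F} {z : E} (hΦ : DifferentiableAt ℂ Φ (σE z)) : DifferentiableAt ℂ (fun Q => σF (Φ (σE Q))) z := by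
  obtain ⟨L, _, hL⟩ := exists_hasFDerivAt_sandwich σE hσE σF hσF hΦ
  exact hL.differentiableAt

/-- **The vector-valued symmetry principle on a σE-invariant open set** («analytic … in the region obtained by reflecting»):
`Φ` holomorphic on an open `s` with `σE(s) ⊆ s` ⇒ `Q ↦ σF (Φ (σE Q))` holomorphic on `s`. [cite: AhlforsCA1979, Ch. 4 §6.5 p. 172] -/
theorem differentiableOn_sandwich (σE : E →L[ℝ] E) (hσE : ∀ (c : ℂ) (x : E), σE (c • x) = conj c • σE x)
    (σF : F →L[ℝ] F) (hσF : ∀ (c : ℂ) (y : F), σF (c • y) = conj c • σF y)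
    {Φ : E → F} {s : Set E} (hs : IsOpen s) (hmaps : MapsTo σE s s) (hΦ : DifferentiableOn ℂ Φ s) :
    DifferentiableOn ℂ (fun Q => σF (Φ (σE Q))) s :=
  fun _ hz => (differentiableAt_sandwich σE hσE σF hσF (hΦ.differentiableAt (hs.mem_nhds (hmaps hz)))).differentiableWithinAt

/-! ## §2 The symmetrised map `Q ↦ 2⁻¹ • (Φ Q + σF (Φ (σE Q)))` -/

/-- **The vector-valued symmetrised map is holomorphic** on every σE-invariant open set where `Φ` is.
[cite: AhlforsCA1979, Ch. 4 §6.5 p. 172] -/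
theorem differentiableOn_symmetriseV (σE : E →L[ℝ] E) (hσE : ∀ (c : ℂ) (x : E), σE (c • x) = conj c • σE x)
    (σF : F →L[ℝ] F) (hσF : ∀ (c : ℂ) (y : F), σF (c • y) = conj c • σF y)
    {Φ : E → F} {s : Set E} (hs : IsOpen s) (hmaps : MapsTo σE s s) (hΦ : DifferentiableOn ℂ Φ s) :
    DifferentiableOn ℂ (fun Q => (2⁻¹ : ℂ) • (Φ Q + σF (Φ (σE Q)))) s :=
  (hΦ.add (differentiableOn_sandwich σE hσE σF hσF hs hmaps hΦ)).const_smul (2⁻¹ : ℂ)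

/-- An isometric ℝ-linear map sends every ball about the origin into itself. [folklore] -/
private theorem mapsTo_ball_of_norm_eq (σE : E →L[ℝ] E) (hiso : ∀ x, ‖σE x‖ = ‖x‖) (R : ℝ) :
    MapsTo σE (ball (0 : E) R) (ball 0 R) := fun x hx => by
  rw [mem_ball_zero_iff] at hx ⊢; rwa [hiso]

/-- Same bound: both σ's isometric and `‖Φ‖ ≤ M` on `ball 0 R` ⇒ the symmetrised map is bounded by `M` there (triangle
inequality). [folklore] -/
private theorem norm_symmetriseV_le (σE : E →L[ℝ] E) (hisoE : ∀ x, ‖σE x‖ = ‖x‖) (σF : F →L[ℝ] F)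
    (hisoF : ∀ y, ‖σF y‖ = ‖y‖) {Φ : E → F} {R M : ℝ} (hM : ∀ Q ∈ ball (0 : E) R, ‖Φ Q‖ ≤ M) {Q : E}
    (hQ : Q ∈ ball (0 : E) R) : ‖(2⁻¹ : ℂ) • (Φ Q + σF (Φ (σE Q)))‖ ≤ M := by
  have hσQ : σE Q ∈ ball (0 : E) R := mapsTo_ball_of_norm_eq σE hisoE R hQ
  rw [norm_smul, norm_inv, Complex.norm_two]
  have h : ‖Φ Q + σF (Φ (σE Q))‖ ≤ M + M :=
    (norm_add_le _ _).trans (add_le_add (hM Q hQ) (by rw [hisoF]; exact hM _ hσQ))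
  linarith

/-- **At a σE-fixed point the symmetrised map is `2⁻¹ • (Φ Q + σF (Φ Q))`** — the «σF-real part» of `Φ Q` (Ahlfors' «f real on
the real axis», automatic for the symmetrised map). [cite: AhlforsCA1979, Ch. 4 §6.5 p. 172] -/
theorem symmetriseV_of_fixed (σE : E →L[ℝ] E) (σF : F →L[ℝ] F) (Φ : E → F) {Q : E} (hQ : σE Q = Q) :
    (2⁻¹ : ℂ) • (Φ Q + σF (Φ (σE Q))) = (2⁻¹ : ℂ) • (Φ Q + σF (Φ Q)) := by
  rw [hQ]

/-- … and that value IS σF-fixed — «f real on the real axis» — when `σF` is a conjugate-linear involution.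
[cite: AhlforsCA1979, Ch. 4 §6.5 p. 172] -/
theorem fixed_symmetriseV_of_fixed (σE : E →L[ℝ] E) (σF : F →L[ℝ] F)
    (hσF : ∀ (c : ℂ) (y : F), σF (c • y) = conj c • σF y) (hσFF : ∀ y, σF (σF y) = y) (Φ : E → F) {Q : E}
    (hQ : σE Q = Q) : σF ((2⁻¹ : ℂ) • (Φ Q + σF (Φ (σE Q)))) = (2⁻¹ : ℂ) • (Φ Q + σF (Φ (σE Q))) := by
  rw [hQ, hσF, map_add, hσFF, map_inv₀, map_ofNat, add_comm]

/-- Differences of the symmetrised map at two σE-fixed points are dominated by those of `Φ` (σF isometric). [folklore] -/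
private theorem norm_symmetriseV_sub_le_of_fixed (σE : E →L[ℝ] E) (σF : F →L[ℝ] F) (hisoF : ∀ y, ‖σF y‖ = ‖y‖)
    (Φ : E → F) {Q Q' : E} (hQ : σE Q = Q) (hQ' : σE Q' = Q') :
    ‖(2⁻¹ : ℂ) • (Φ Q + σF (Φ (σE Q))) - (2⁻¹ : ℂ) • (Φ Q' + σF (Φ (σE Q')))‖ ≤ ‖Φ Q - Φ Q'‖ := by
  rw [hQ, hQ', ← smul_sub, add_sub_add_comm, ← map_sub, norm_smul, norm_inv, Complex.norm_two]
  have h : ‖Φ Q - Φ Q' + σF (Φ Q - Φ Q')‖ ≤ ‖Φ Q - Φ Q'‖ + ‖Φ Q - Φ Q'‖ :=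
    (norm_add_le _ _).trans (add_le_add le_rfl (hisoF _).le)
  linarith

/-- **Equivariance** (Ahlfors' `f(z) = \overline{f(z̄)}` for the symmetrised map): for conjugate-linear INVOLUTIONS `σE`, `σF`,
`Φ^sym (σE Q) = σF (Φ^sym Q)`. [cite: AhlforsCA1979, Ch. 4 §6.5 p. 172] -/
theorem symmetriseV_apply_conjLinear (σE : E →L[ℝ] E) (hσEE : ∀ Q, σE (σE Q) = Q) (σF : F →L[ℝ] F)
    (hσF : ∀ (c : ℂ) (y : F), σF (c • y) = conj c • σF y) (hσFF : ∀ y, σF (σF y) = y) (Φ : E → F) (Q : E) :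
    (2⁻¹ : ℂ) • (Φ (σE Q) + σF (Φ (σE (σE Q)))) = σF ((2⁻¹ : ℂ) • (Φ Q + σF (Φ (σE Q)))) := by
  rw [hσEE, hσF, map_add, hσFF, map_inv₀, map_ofNat, add_comm]

/-- **THE VECTOR-VALUED SYMMETRY PRINCIPLE ON A BALL, BUNDLED** (Ahlfors' §6.5 for `Φ^sym Q := 2⁻¹ • (Φ Q + σF (Φ (σE Q)))`
through ISOMETRIC conjugate-linear `σE`, `σF`): for `Φ : E → F` holomorphic on `ball 0 R` and bounded by `M` there — (i) `Φ^sym`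
is holomorphic on `ball 0 R`; (ii) `‖Φ^sym‖ ≤ M` on the ball; (iii) at every σE-fixed point `Φ^sym Q = 2⁻¹ • (Φ Q + σF (Φ Q))`;
(iv) at two σE-fixed points `‖Φ^sym Q − Φ^sym Q′‖ ≤ ‖Φ Q − Φ Q′‖`; (v) if `σF` is an involution, the values (iii) are σF-fixed;
(vi) if both are involutions, `Φ^sym (σE Q) = σF (Φ^sym Q)`. [cite: AhlforsCA1979, Ch. 4 §6.5 p. 172] -/
theorem symmetriseV_ball (σE : E →L[ℝ] E) (hσE : ∀ (c : ℂ) (x : E), σE (c • x) = conj c • σE x)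
    (hisoE : ∀ x, ‖σE x‖ = ‖x‖) (σF : F →L[ℝ] F) (hσF : ∀ (c : ℂ) (y : F), σF (c • y) = conj c • σF y)
    (hisoF : ∀ y, ‖σF y‖ = ‖y‖) {Φ : E → F} {R M : ℝ} (hΦ : DifferentiableOn ℂ Φ (ball 0 R))
    (hM : ∀ Q ∈ ball (0 : E) R, ‖Φ Q‖ ≤ M) :
    DifferentiableOn ℂ (fun Q => (2⁻¹ : ℂ) • (Φ Q + σF (Φ (σE Q)))) (ball 0 R) ∧
      (∀ Q ∈ ball (0 : E) R, ‖(2⁻¹ : ℂ) • (Φ Q + σF (Φ (σE Q)))‖ ≤ M) ∧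
      (∀ Q, σE Q = Q → (2⁻¹ : ℂ) • (Φ Q + σF (Φ (σE Q))) = (2⁻¹ : ℂ) • (Φ Q + σF (Φ Q))) ∧
      (∀ Q Q', σE Q = Q → σE Q' = Q' →
        ‖(2⁻¹ : ℂ) • (Φ Q + σF (Φ (σE Q))) - (2⁻¹ : ℂ) • (Φ Q' + σF (Φ (σE Q')))‖ ≤ ‖Φ Q - Φ Q'‖) ∧
      ((∀ y, σF (σF y) = y) → ∀ Q, σE Q = Q →
        σF ((2⁻¹ : ℂ) • (Φ Q + σF (Φ (σE Q)))) = (2⁻¹ : ℂ) • (Φ Q + σF (Φ (σE Q)))) ∧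
      ((∀ Q, σE (σE Q) = Q) → (∀ y, σF (σF y) = y) → ∀ Q,
        (2⁻¹ : ℂ) • (Φ (σE Q) + σF (Φ (σE (σE Q)))) = σF ((2⁻¹ : ℂ) • (Φ Q + σF (Φ (σE Q))))) :=
  ⟨differentiableOn_symmetriseV σE hσE σF hσF isOpen_ball (mapsTo_ball_of_norm_eq σE hisoE R) hΦ,
    fun _ hQ => norm_symmetriseV_le σE hisoE σF hisoF hM hQ, fun _ hQ => symmetriseV_of_fixed σE σF Φ hQ,
    fun _ _ hQ hQ' => norm_symmetriseV_sub_le_of_fixed σE σF hisoF Φ hQ hQ',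
    fun hσFF _ hQ => fixed_symmetriseV_of_fixed σE σF hσF hσFF Φ hQ,
    fun hσEE hσFF Q => symmetriseV_apply_conjLinear σE hσEE σF hσF hσFF Φ Q⟩

end Abstract

/-! ## §3 The `star` form: conjugations given by Mathlib's `star` (no ℝ-linear structure in the statements) -/

section StarForm

variable {E F : Type*} [NormedAddCommGroup E] [NormedSpace ℂ E] [StarAddMonoid E] [NormedStarGroup E] [StarModule ℂ E]
  [NormedAddCommGroup F] [NormedSpace ℂ F] [StarAddMonoid F] [NormedStarGroup F] [StarModule ℂ F]

/-- §3.0 On a complex normed space with an isometric `star` compatible with the ℂ-action, `star` IS an ℝ-linear continuous map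
(for the ℝ-structure RESTRICTED FROM `ℂ`, `NormedSpace.complexToReal` — the structure under which §1–§2 and the sibling file's
scalar statements are typed), conjugate-linear, isometric and involutive — i.e. it meets every hypothesis of §1–§2 (private
plumbing: the public statements below mention `star` only). [folklore] -/
private theorem exists_star_clm (E : Type*) [NormedAddCommGroup E] [NormedSpace ℂ E] [StarAddMonoid E] [NormedStarGroup E]
    [StarModule ℂ E] :
    ∃ σ : E →L[ℝ] E, (∀ x, σ x = star x) ∧ (∀ (c : ℂ) (x : E), σ (c • x) = conj c • σ x) ∧
      (∀ x, ‖σ x‖ = ‖x‖) ∧ ∀ x, σ (σ x) = x := by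
  refine ⟨{ toFun := star, map_add' := star_add,
            map_smul' := fun r x => ?_, cont := continuous_star }, fun _ => rfl, fun c x => ?_, fun x => norm_star x,
    fun x => star_star x⟩
  · rw [RingHom.id_apply, ← Complex.coe_smul, ← Complex.coe_smul, star_smul, Complex.star_def, Complex.conj_ofReal]
  · show star (c • x) = conj c • star x
    rw [star_smul, Complex.star_def]

/-- **`Q ↦ star (Φ (star Q))` is holomorphic on every `star`-invariant open set where `Φ` is** (the `star` form of §1).
[cite: AhlforsCA1979, Ch. 4 §6.5 p. 172] -/
theorem differentiableOn_star_comp_star {Φ : E → F} {s : Set E} (hs : IsOpen s) (hmaps : MapsTo star s s)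
    (hΦ : DifferentiableOn ℂ Φ s) : DifferentiableOn ℂ (fun Q => star (Φ (star Q))) s := by
  obtain ⟨σE, hEa, hσE, -, -⟩ := exists_star_clm E
  obtain ⟨σF, hFa, hσF, -, -⟩ := exists_star_clm F
  have hmaps' : MapsTo σE s s := fun x hx => by rw [hEa]; exact hmaps hx
  refine (differentiableOn_sandwich σE hσE σF hσF hs hmaps' hΦ).congr fun Q _ => ?_
  rw [hEa, hFa]

omit [NormedSpace ℂ E] [StarModule ℂ E] in
/-- `star` maps every ball about the origin into itself (it is isometric). [folklore] -/
private theorem mapsTo_star_ball (R : ℝ) : MapsTo (star : E → E) (ball (0 : E) R) (ball 0 R) := fun x hx => by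
  rw [mem_ball_zero_iff] at hx ⊢; rwa [norm_star]

/-- **… in particular on every ball about the origin** (a `star`-symmetric region): `Φ` holomorphic on `ball 0 R` ⇒
`Q ↦ star (Φ (star Q))` holomorphic on `ball 0 R`. [cite: AhlforsCA1979, Ch. 4 §6.5 p. 172] -/
theorem differentiableOn_star_comp_star_ball {Φ : E → F} {R : ℝ} (hΦ : DifferentiableOn ℂ Φ (ball 0 R)) :
    DifferentiableOn ℂ (fun Q => star (Φ (star Q))) (ball 0 R) :=
  differentiableOn_star_comp_star isOpen_ball (mapsTo_star_ball R) hΦ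

/-- **THE SYMMETRY PRINCIPLE ON A BALL THROUGH `star`, BUNDLED** (`Φ^sym Q := 2⁻¹ • (Φ Q + star (Φ (star Q)))`): for `Φ : E → F`
holomorphic on `ball 0 R` and bounded by `M` there — (i) `Φ^sym` is holomorphic on `ball 0 R`; (ii) `‖Φ^sym‖ ≤ M` on the ball;
(iii) at every SELF-ADJOINT `Q` («real table»), `Φ^sym Q = 2⁻¹ • (Φ Q + star (Φ Q))`, (iv) which is SELF-ADJOINT; (v) at two
self-adjoint points `‖Φ^sym Q − Φ^sym Q′‖ ≤ ‖Φ Q − Φ Q′‖`; (vi) `Φ^sym (star Q) = star (Φ^sym Q)` («f(z) = \overline{f(z̄)}»).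
No ℝ-linear structure occurs in the statement. [cite: AhlforsCA1979, Ch. 4 §6.5 p. 172] -/
theorem symmetrise_star_ball {Φ : E → F} {R M : ℝ} (hΦ : DifferentiableOn ℂ Φ (ball 0 R))
    (hM : ∀ Q ∈ ball (0 : E) R, ‖Φ Q‖ ≤ M) :
    DifferentiableOn ℂ (fun Q => (2⁻¹ : ℂ) • (Φ Q + star (Φ (star Q)))) (ball 0 R) ∧
      (∀ Q ∈ ball (0 : E) R, ‖(2⁻¹ : ℂ) • (Φ Q + star (Φ (star Q)))‖ ≤ M) ∧
      (∀ Q, IsSelfAdjoint Q → (2⁻¹ : ℂ) • (Φ Q + star (Φ (star Q))) = (2⁻¹ : ℂ) • (Φ Q + star (Φ Q))) ∧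
      (∀ Q, IsSelfAdjoint Q → IsSelfAdjoint ((2⁻¹ : ℂ) • (Φ Q + star (Φ (star Q))))) ∧
      (∀ Q Q', IsSelfAdjoint Q → IsSelfAdjoint Q' →
        ‖(2⁻¹ : ℂ) • (Φ Q + star (Φ (star Q))) - (2⁻¹ : ℂ) • (Φ Q' + star (Φ (star Q')))‖ ≤ ‖Φ Q - Φ Q'‖) ∧
      ∀ Q, (2⁻¹ : ℂ) • (Φ (star Q) + star (Φ (star (star Q)))) = star ((2⁻¹ : ℂ) • (Φ Q + star (Φ (star Q)))) := by
  obtain ⟨σE, hEa, hσE, hisoE, -⟩ := exists_star_clm E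
  obtain ⟨σF, hFa, hσF, hisoF, -⟩ := exists_star_clm F
  obtain ⟨h1, h2, h3, h4, h5, h6⟩ := symmetriseV_ball σE hσE hisoE σF hσF hisoF hΦ hM
  simp only [hEa, hFa] at h1 h2 h3 h4 h5 h6
  exact ⟨h1, h2, fun Q hQ => h3 Q hQ.star_eq, fun Q hQ => h5 (fun y => star_star y) Q hQ.star_eq,
    fun Q Q' hQ hQ' => h4 Q Q' hQ.star_eq hQ'.star_eq, h6 (fun Q => star_star Q) fun y => star_star y⟩

omit [NormedSpace ℂ E] [NormedStarGroup E] [StarModule ℂ E] [NormedStarGroup F] in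
/-- «f real on the real axis», in Mathlib's vocabulary: the value of the `star`-symmetrised map at a self-adjoint point is the
REAL PART `ℜ (Φ Q)` (`realPart`, `2⁻¹ • (y + star y)` for the ℝ-action restricted from `ℂ`). [cite: AhlforsCA1979, Ch. 4 §6.5 p. 172] -/
theorem symmetrise_star_eq_realPart (Φ : E → F) {Q : E} (hQ : IsSelfAdjoint Q) :
    (2⁻¹ : ℂ) • (Φ Q + star (Φ (star Q))) = ((ℜ (Φ Q) : selfAdjoint F) : F) := by
  rw [hQ.star_eq, realPart_apply_coe, ← Complex.coe_smul, Complex.ofReal_inv, Complex.ofReal_ofNat]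

end StarForm

/-! ## §4 The sequence space `lp (fun _ : ι => ℂ) ∞`: `star` = coordinatewise conjugation; self-adjoint = real coordinates -/

section Lp

variable {ι κ : Type*}

/-- The instances §3 needs on `lp (fun _ : ι => ℂ) ∞` are Mathlib's. [folklore] -/
example : StarModule ℂ (lp (fun _ : ι => ℂ) ∞) := inferInstance

/-- … with the isometric star. [folklore] -/
example : NormedStarGroup (lp (fun _ : ι => ℂ) ∞) := inferInstance

/-- … and likewise for BOUNDED FUNCTIONS into it (sup norm), e.g. future profiles indexed by a discrete type. [folklore] -/
example {α : Type*} [TopologicalSpace α] : StarModule ℂ (BoundedContinuousFunction α (lp (fun _ : ι => ℂ) ∞)) :=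
  inferInstance

/-- [folklore] -/
example {α : Type*} [TopologicalSpace α] : NormedStarGroup (BoundedContinuousFunction α (lp (fun _ : ι => ℂ) ∞)) :=
  inferInstance

/-- `star` on `lp (fun _ : ι => ℂ) ∞` is coordinatewise complex conjugation (Mathlib's `lp.star_apply`). [folklore] -/
private theorem lp_star_apply (f : lp (fun _ : ι => ℂ) ∞) (i : ι) :
    (star f : lp (fun _ : ι => ℂ) ∞) i = conj (f i) := by
  rw [lp.star_apply, Complex.star_def]

/-- A vector of `lp (fun _ : ι => ℂ) ∞` is self-adjoint iff all its coordinates are real (`conj (f i) = f i`). [folklore] -/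
private theorem isSelfAdjoint_lp_iff (f : lp (fun _ : ι => ℂ) ∞) : IsSelfAdjoint f ↔ ∀ i, conj (f i) = f i := by
  refine ⟨fun h i => ?_, fun h => lp.ext (funext fun i => ?_)⟩
  · rw [← lp_star_apply, h.star_eq]
  · rw [lp_star_apply, h i]

/-- `2⁻¹ • (f + star f)` is, on `lp (fun _ : ι => ℂ) ∞`, the coordinatewise real part. [folklore] -/
private theorem lp_symmetrise_apply (f : lp (fun _ : ι => ℂ) ∞) (i : ι) :
    ((2⁻¹ : ℂ) • (f + star f) : lp (fun _ : ι => ℂ) ∞) i = ((f i).re : ℂ) := by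
  rw [lp.coeFn_smul, Pi.smul_apply, lp.coeFn_add, Pi.add_apply, lp_star_apply, Complex.add_conj, smul_eq_mul]
  push_cast
  ring

/-- **THE `lp`-VALUED SYMMETRISED MAP AT A SELF-ADJOINT ARGUMENT IS THE COORDINATEWISE REAL PART OF `Φ`** («f real on the real
axis», vector-valued): for any type `E` with a `star` and `Φ : E → lp (fun _ : κ => ℂ) ∞`, at `Q` with `star Q = Q`,
`(2⁻¹ • (Φ Q + star (Φ (star Q)))) k = ((Φ Q k).re : ℂ)`. [cite: AhlforsCA1979, Ch. 4 §6.5 p. 172] -/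
theorem symmetrise_star_apply_of_isSelfAdjoint {E : Type*} [Star E] (Φ : E → lp (fun _ : κ => ℂ) ∞) {Q : E}
    (hQ : IsSelfAdjoint Q) (k : κ) :
    ((2⁻¹ : ℂ) • (Φ Q + star (Φ (star Q))) : lp (fun _ : κ => ℂ) ∞) k = (((Φ Q : lp (fun _ : κ => ℂ) ∞) k).re : ℂ) := by
  rw [hQ.star_eq, lp_symmetrise_apply]

/-- **THE SYMMETRY PRINCIPLE BETWEEN TWO SEQUENCE SPACES, BUNDLED, WITH THE AXIS OF SYMMETRY IDENTIFIED** (tables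
`E = lp (fun _ : ι => ℂ) ∞`, values `F = lp (fun _ : κ => ℂ) ∞`, both reflected coordinatewise by `star`;
`Φ^sym Q := 2⁻¹ • (Φ Q + star (Φ (star Q)))`): (o) the points of symmetry — the self-adjoint tables — are EXACTLY the tables
with real coordinates; and for `Φ` holomorphic on `ball 0 R`, bounded by `M` there: (i) `Φ^sym` is holomorphic on `ball 0 R`;
(ii) `‖Φ^sym‖ ≤ M` there; (iii) at a real table `Φ^sym Q` is, coordinatewise, `Re (Φ Q)`; (iv) and is itself a real vector;
(v) at two real tables `‖Φ^sym Q − Φ^sym Q′‖ ≤ ‖Φ Q − Φ Q′‖`; (vi) `Φ^sym (star Q) = star (Φ^sym Q)`.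
[cite: AhlforsCA1979, Ch. 4 §6.5 p. 172] -/
theorem symmetrise_star_lp_ball {Φ : lp (fun _ : ι => ℂ) ∞ → lp (fun _ : κ => ℂ) ∞} {R M : ℝ}
    (hΦ : DifferentiableOn ℂ Φ (ball 0 R)) (hM : ∀ Q ∈ ball (0 : lp (fun _ : ι => ℂ) ∞) R, ‖Φ Q‖ ≤ M) :
    (∀ Q : lp (fun _ : ι => ℂ) ∞, IsSelfAdjoint Q ↔ ∀ i, conj (Q i) = Q i) ∧
      DifferentiableOn ℂ (fun Q => (2⁻¹ : ℂ) • (Φ Q + star (Φ (star Q)))) (ball 0 R) ∧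
      (∀ Q ∈ ball (0 : lp (fun _ : ι => ℂ) ∞) R, ‖(2⁻¹ : ℂ) • (Φ Q + star (Φ (star Q)))‖ ≤ M) ∧
      (∀ Q, IsSelfAdjoint Q → ∀ k,
        ((2⁻¹ : ℂ) • (Φ Q + star (Φ (star Q))) : lp (fun _ : κ => ℂ) ∞) k = (((Φ Q : lp (fun _ : κ => ℂ) ∞) k).re : ℂ)) ∧
      (∀ Q, IsSelfAdjoint Q → ∀ k,
        conj (((2⁻¹ : ℂ) • (Φ Q + star (Φ (star Q))) : lp (fun _ : κ => ℂ) ∞) k) =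
          ((2⁻¹ : ℂ) • (Φ Q + star (Φ (star Q))) : lp (fun _ : κ => ℂ) ∞) k) ∧
      (∀ Q Q', IsSelfAdjoint Q → IsSelfAdjoint Q' →
        ‖(2⁻¹ : ℂ) • (Φ Q + star (Φ (star Q))) - (2⁻¹ : ℂ) • (Φ Q' + star (Φ (star Q')))‖ ≤ ‖Φ Q - Φ Q'‖) ∧
      ∀ Q, (2⁻¹ : ℂ) • (Φ (star Q) + star (Φ (star (star Q)))) = star ((2⁻¹ : ℂ) • (Φ Q + star (Φ (star Q)))) := by
  obtain ⟨h1, h2, -, h4, h5, h6⟩ := symmetrise_star_ball hΦ hM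
  exact ⟨isSelfAdjoint_lp_iff, h1, h2, fun Q hQ k => symmetrise_star_apply_of_isSelfAdjoint Φ hQ k,
    fun Q hQ => (isSelfAdjoint_lp_iff _).1 (h4 Q hQ), h5, h6⟩

end Lp

/-! ## §T Sanity: non-vacuity on `lp (fun _ : ι => ℂ) ∞`, and the scalar recovery `F := ℂ` -/

/-- NON-VACUITY of `symmetrise_star_ball` on the sequence space (`E = F = lp (fun _ : ι => ℂ) ∞`, `Φ = id`, `M = R`): every
hypothesis is met and the six conclusions hold. [folklore] -/
example {ι : Type*} (R : ℝ) :
    DifferentiableOn ℂ (fun Q : lp (fun _ : ι => ℂ) ∞ => (2⁻¹ : ℂ) • (Q + star (star Q))) (ball 0 R) ∧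
      ∀ Q : lp (fun _ : ι => ℂ) ∞, IsSelfAdjoint Q → IsSelfAdjoint ((2⁻¹ : ℂ) • (Q + star (star Q))) := by
  obtain ⟨h1, -, -, h4, -, -⟩ := symmetrise_star_ball (E := lp (fun _ : ι => ℂ) ∞) (F := lp (fun _ : ι => ℂ) ∞)
    (Φ := fun Q => Q) (R := R) (M := R) differentiableOn_id fun Q hQ => (mem_ball_zero_iff.mp hQ).le
  exact ⟨h1, h4⟩

/-- SCALAR RECOVERY (`F := ℂ`, where `star = conj`): at a self-adjoint table the `star`-symmetrised scalar map is the real part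
`((Φ Q).re : ℂ)` — clause (iii) of `Literature.Analysis.Complex.SymmetryPrincipleBanach.symmetrise_ball`. [folklore] -/
example {ι : Type*} (Φ : lp (fun _ : ι => ℂ) ∞ → ℂ) {Q : lp (fun _ : ι => ℂ) ∞} (hQ : IsSelfAdjoint Q) :
    (2⁻¹ : ℂ) • (Φ Q + star (Φ (star Q))) = ((Φ Q).re : ℂ) := by
  rw [hQ.star_eq, Complex.star_def, Complex.add_conj, smul_eq_mul]
  push_cast
  ring

/-- SCALAR RECOVERY, holomorphy clause: for `Φ : lp (fun _ : ι => ℂ) ∞ → ℂ` holomorphic and bounded on a ball, the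
`star`-symmetrised map is holomorphic there and real (= `re`) at self-adjoint tables. [folklore] -/
example {ι : Type*} {Φ : lp (fun _ : ι => ℂ) ∞ → ℂ} {R M : ℝ} (hΦ : DifferentiableOn ℂ Φ (ball 0 R))
    (hM : ∀ Q ∈ ball (0 : lp (fun _ : ι => ℂ) ∞) R, ‖Φ Q‖ ≤ M) :
    DifferentiableOn ℂ (fun Q => (2⁻¹ : ℂ) • (Φ Q + star (Φ (star Q)))) (ball 0 R) ∧
      ∀ Q : lp (fun _ : ι => ℂ) ∞, IsSelfAdjoint Q → (2⁻¹ : ℂ) • (Φ Q + star (Φ (star Q))) = ((Φ Q).re : ℂ) := by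
  obtain ⟨h1, -, h3, -, -, -⟩ := symmetrise_star_ball (F := ℂ) hΦ hM
  refine ⟨h1, fun Q hQ => ?_⟩
  rw [h3 Q hQ, Complex.star_def, Complex.add_conj, smul_eq_mul]
  push_cast
  ring

end Literature.Analysis.Complex.SymmetryPrincipleBanachStar

end
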